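import Mathlib
import Literature.NumberTheory.LFunctions.Zhang2022.Section13ZeroSumQuadratic
import HarnessLib

/-!
# Zhang (2022) §13 p. 75, (13.11): the zero-sum over the FAMILY `ψ ∈ Ψ₁` from a LINE mean-value bound —
# `Σ_{ψ∈Ψ₁}‖Σ_{ρ∈𝔷(ψ)} |L(ρ+β₁,ψ)/L′(ρ,ψ)|·H_ψ(ρ)·ω(ρ)‖ ≤ C·𝓛⁹·MV + K·𝔓·H_max·e^{−𝓛¹⁰/8}`

Topic `Literature/NumberTheory/LFunctions/Zhang2022` (Landau–Siegel audit tree; verdict-neutral).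
Y. Zhang, *Discrete mean estimates and the Landau–Siegel zero*, arXiv:2211.02515v1 (2022)
[Zhang2022LandauSiegel], §13 p. 75 (tex L3806–L3817) — an unrefereed manuscript under adjudication;
nothing here asserts or denies its Theorems 1–2. Lane ZHANG-L (WP14, zero-side helper of record; GAP row
G-L3t6-3, (13.11) "not carried out in print").

The generic per-character bound `zeroSum_weight_le_of_prop22` (`Section13ZeroSumBound`: the (2.34)/residue
conversion + Lemma 5.9 on `𝒥(±α)`) leaves, for each `ψ`, the two line integrals
`∫_{−𝓛₁}^{𝓛₁}‖H_ψ(±α+s₀+iv)‖‖ω(±α+s₀+iv)‖dv`. For the terms of `𝓔` whose co-factors involve the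
`L`-values themselves (Lemma 6.1 "and 3.3": `Σ_ψ|L(s+β_j,ψ)|²` on the two lines), the natural input is a
mean value over the family at a FIXED point of the lines. This file does the bookkeeping once, for an
arbitrary family `(H_ψ)_{ψ∈Ψ₁}` of co-factors holomorphic on the upper half-plane, bounded by `H_max` on
the strip, with `Σ_{ψ∈Ψ₁}‖H_ψ(s)‖ ≤ MV` at every point `s` of the two lines `Re s = ½ ± α`,
`|Im s − 2πt₀| ≤ 𝓛₁`:

* `zeroSum_family_le_of_lineBound_of_prop22` — for `c′ ≥ 0` with `Skeleton.Prop22 c′`: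
  `Σ_{ψ∈Ψ₁}‖Σ_{ρ∈𝔷(ψ)} |L(ρ+β₁,ψ)/L′(ρ,ψ)|·H_ψ(ρ)·ω(ρ)‖ ≤ C·𝓛⁹·MV + K·𝔓·H_max·e^{−𝓛¹⁰/8}` for all large
  `D` (finite sum through the integral, `∫_{𝒥(±α)}|ω| ≤ 2πe^{1/4}` (7.4), `#Ψ₁ ≤ 𝔓` (2.9));
  `zeroSum_family_le_of_lineBound_eventually` — the same for all large `c′`, NO hypothesis.

(`zeroSum_dirPoly_sq_le_of_prop22` of `Section13ZeroSumQuadratic` is the special case `H_ψ = F·F̄(1−·)`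
with `MV = 𝔓·Σ|c(n)|²(n^{−(1+2α)}+n^{−(1−2α)})` from Lemma 3.3 (i).) Theorems only: no new definition,
no new fact, axioms standard.

## References

* Y. Zhang, arXiv:2211.02515v1 (2022), §13 p. 75; §7 (7.4); §2 (2.9). [cite: Zhang2022LandauSiegel, §13 p.75]
-/

noncomputable section

open Complex Real Set Filter Topology MeasureTheory intervalIntegral

namespace Literature.NumberTheory.LFunctions.Zhang2022.Typed.Section13

open Skeleton GammaFactor Section8aStatements

set_option maxHeartbeats 800000 in
/-- **The family zero-sum from a line mean-value bound, from Proposition 2.2** (§13 p.75 "(2.34),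
Cauchy's inequality, …, Lemma 5.9, 6.1 and 3.3" — the bookkeeping between the per-`ψ` conversion and the
mean values over `ψ`): for `c′ ≥ 0` with `Skeleton.Prop22 c′` there are `K, C ≥ 0` such that for all large
`D`, every real primitive `χ`, every family `H : Chr D → ℂ → ℂ` of functions holomorphic on the upper
half-plane with `‖H_ψ(s)‖ ≤ H_max` on `|σ−½| ≤ α`, `|t−2πt₀| ≤ 𝓛₁+1` (all `ψ`), and every `MV ≥ 0` with
`Σ_{ψ∈Ψ₁}‖H_ψ(s)‖ ≤ MV` whenever `|Re s − ½| = α`, `|Im s − 2πt₀| ≤ 𝓛₁`: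
`Σ_{ψ∈Ψ₁}‖Σ_{ρ∈𝔷(ψ)} |L(ρ+β₁,ψ)/L′(ρ,ψ)|·H_ψ(ρ)·ω(ρ)‖ ≤ C·𝓛⁹·MV + K·𝔓·H_max·e^{−𝓛¹⁰/8}`.
[cite: Zhang2022LandauSiegel, §13 p.75, tex L3806–L3817] -/
theorem zeroSum_family_le_of_lineBound_of_prop22 {c' : ℝ} (hc' : 0 ≤ c') (h22 : Prop22 c') :
    ∃ K : ℝ, 0 ≤ K ∧ ∃ C : ℝ, 0 ≤ C ∧ ForAllLarge fun D _ χ =>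
      ∀ (H : Chr D → ℂ → ℂ) (Hmax MV : ℝ), 0 ≤ Hmax → 0 ≤ MV →
      (∀ x : Chr D, ∀ z : ℂ, 0 < z.im → DifferentiableAt ℂ (H x) z) →
      (∀ x : Chr D, ∀ s : ℂ, |s.re - 1 / 2| ≤ alpha D → |s.im - 2 * π * t0 D| ≤ ell1 D + 1 →
        ‖H x s‖ ≤ Hmax) →
      (∀ s : ℂ, |s.re - 1 / 2| = alpha D → |s.im - 2 * π * t0 D| ≤ ell1 D →
        ∑ x ∈ finsetOf (PsiOne χ), ‖H x s‖ ≤ MV) →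
      (∑ x ∈ finsetOf (PsiOne χ), ‖∑ ρ ∈ finsetOf (zeroSet D x),
          ((‖x.ψ.LFunction (ρ + beta1 c' D) / deriv x.ψ.LFunction ρ‖ : ℝ) : ℂ) * H x ρ * omegaW D ρ‖) ≤
        C * ell D ^ 9 * MV + K * frakP D * Hmax * Real.exp (-(ell D ^ 10 / 8)) := by
  obtain ⟨K, hK0, C₇, hC₇, D₁, hW⟩ := zeroSum_weight_le_of_prop22 hc' h22
  refine ⟨K, hK0, 2 * (C₇ * (2 * π * Real.exp (1 / 4))), by positivity, max D₁ (max 3 ⌈Real.exp 2⌉₊),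
    fun D _ χ hD hq hp H Hmax MV hHmax hMV hH hHb hline => ?_⟩
  have hD₁ : D₁ ≤ D := (le_max_left _ _).trans hD
  have hD3 : 3 ≤ D := (le_max_left _ _).trans ((le_max_right _ _).trans hD)
  have hDe : ⌈Real.exp 2⌉₊ ≤ D := (le_max_right _ _).trans ((le_max_right _ _).trans hD)
  have hℓ2 : 2 ≤ ell D := by
    have h1 : Real.exp 2 ≤ D := (Nat.le_ceil _).trans (by exact_mod_cast hDe)
    have hD0 : (0 : ℝ) < D := (Real.exp_pos _).trans_le h1
    rw [ell, Real.le_log_iff_exp_le hD0]; exact h1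
  have hℓ1 : 1 < ell D := one_lt_ell hD3
  have hℓpos : 0 < ell D := by linarith
  have hlogP : Real.log (bigP D) = ell D ^ 9 := by rw [bigP, Real.log_exp]
  have hα : 0 < alpha D := by
    rw [alpha, hlogP]; exact div_pos Real.pi_pos (pow_pos hℓpos 9)
  have hℓ1pos : 0 < ell1 D := by rw [ell1]; positivity
  have hℓ2pos : 0 < ell2 D := by rw [ell2]; positivity
  have hℓt : ell1 D < 2 * π * t0 D := by
    have h1 : ell1 D ≤ t0 D := pow_le_pow_right₀ hℓ1.le (by norm_num)
    have h2 : 0 < t0 D := lt_of_lt_of_le hℓ1pos h1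
    nlinarith [Real.pi_gt_three]
  have hαℓ2 : |alpha D| ≤ ell2 D := by
    rw [abs_of_pos hα, ell2]
    have h9 : alpha D ≤ π / ell D ^ 9 := by rw [alpha, hlogP]
    have h9' : π / ell D ^ 9 ≤ π := div_le_self Real.pi_pos.le (one_le_pow₀ hℓ1.le)
    have : (4 : ℝ) ≤ ell D ^ 400 := le_trans (by norm_num) (le_trans
      (pow_le_pow_left₀ (by norm_num) hℓ2 2) (pow_le_pow_right₀ hℓ1.le (by norm_num)))
    linarith [Real.pi_lt_four]
  have hαℓ2' : |(-alpha D)| ≤ ell2 D := by rw [abs_neg]; exact hαℓ2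
  have hP0 : 0 ≤ frakP D := frakP_nonneg D
  set T := finsetOf (PsiOne χ) with hT
  -- per character
  have hx : ∀ x ∈ T,
      ‖∑ ρ ∈ finsetOf (zeroSet D x),
          ((‖x.ψ.LFunction (ρ + beta1 c' D) / deriv x.ψ.LFunction ρ‖ : ℝ) : ℂ) * H x ρ * omegaW D ρ‖ ≤
        C₇ * ell D ^ 9 *
            ((∫ v in (-ell1 D)..ell1 D,
                ‖H x ((alpha D : ℂ) + s0 D + v * I)‖ * ‖omegaW D ((alpha D : ℂ) + s0 D + v * I)‖) +
              (∫ v in (-ell1 D)..ell1 D,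
                ‖H x (((-alpha D : ℝ) : ℂ) + s0 D + v * I)‖ *
                  ‖omegaW D (((-alpha D : ℝ) : ℂ) + s0 D + v * I)‖)) +
          K * Hmax * Real.exp (-(ell D ^ 10 / 8)) := fun x hxT =>
    hW D χ hD₁ hq hp x (mem_of_mem_finsetOf hxT) (H x) Hmax hHmax (hH x) (hHb x)
  -- the line integrals summed over `Ψ₁`
  have hlineInt : ∀ z : ℝ, (z = alpha D ∨ z = -alpha D) →
      (∑ x ∈ T, ∫ v in (-ell1 D)..ell1 D,
          ‖H x ((z : ℂ) + s0 D + v * I)‖ * ‖omegaW D ((z : ℂ) + s0 D + v * I)‖) ≤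
        MV * (2 * π * Real.exp (1 / 4)) := by
    intro z hz
    have hzabs : |z| ≤ ell2 D := by
      rcases hz with h | h
      · rw [h]; exact hαℓ2
      · rw [h]; exact hαℓ2'
    have hcont : ∀ x : Chr D, ContinuousOn (fun v : ℝ =>
        ‖H x ((z : ℂ) + s0 D + v * I)‖ * ‖omegaW D ((z : ℂ) + s0 D + v * I)‖)
        (Icc (-ell1 D) (ell1 D)) := fun x =>
      continuousOn_normH_mul_normOmega (D := D) (H x) (hH x) z hℓt
    have hint : ∀ x ∈ T, IntervalIntegrable (fun v : ℝ =>
        ‖H x ((z : ℂ) + s0 D + v * I)‖ * ‖omegaW D ((z : ℂ) + s0 D + v * I)‖) volume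
        (-ell1 D) (ell1 D) := fun x _ =>
      ((hcont x).mono (by rw [Set.uIcc_of_le (by linarith)])).intervalIntegrable
    rw [← intervalIntegral.integral_finsetSum hint]
    have hpt : ∀ v ∈ Icc (-ell1 D) (ell1 D),
        (∑ x ∈ T, ‖H x ((z : ℂ) + s0 D + v * I)‖ * ‖omegaW D ((z : ℂ) + s0 D + v * I)‖) ≤
          MV * ‖omegaW D ((z : ℂ) + s0 D + v * I)‖ := by
      intro v hv
      set s : ℂ := (z : ℂ) + s0 D + v * I with hs
      have hsre : |s.re - 1 / 2| = alpha D := by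
        have : s.re = 1 / 2 + z := by rw [hs]; simp [s0_re]; ring
        rw [this, show 1 / 2 + z - 1 / 2 = z by ring]
        rcases hz with h | h
        · rw [h, abs_of_pos hα]
        · rw [h, abs_neg, abs_of_pos hα]
      have hsim : |s.im - 2 * π * t0 D| ≤ ell1 D := by
        have : s.im = 2 * π * t0 D + v := by rw [hs]; simp [s0_im]
        rw [this, show 2 * π * t0 D + v - 2 * π * t0 D = v by ring, abs_le]
        exact ⟨hv.1, hv.2⟩
      rw [← Finset.sum_mul]
      exact mul_le_mul_of_nonneg_right (hline s hsre hsim) (norm_nonneg _)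
    have hωcont : Continuous fun v : ℝ => ‖omegaW D ((z : ℂ) + s0 D + v * I)‖ :=
      ((Ded81Edge.continuous_omega (ell2 D) (t0 D)).comp
        (by fun_prop : Continuous fun v : ℝ => (z : ℂ) + s0 D + v * I)).norm
    have hint2 : IntervalIntegrable (fun v : ℝ => MV * ‖omegaW D ((z : ℂ) + s0 D + v * I)‖)
        volume (-ell1 D) (ell1 D) := (continuous_const.mul hωcont).intervalIntegrable _ _
    have hintS : IntervalIntegrable (fun v : ℝ => ∑ x ∈ T,
        ‖H x ((z : ℂ) + s0 D + v * I)‖ * ‖omegaW D ((z : ℂ) + s0 D + v * I)‖) volume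
        (-ell1 D) (ell1 D) := by
      refine (continuousOn_finsetSum T fun x _ => hcont x).mono ?_ |>.intervalIntegrable
      rw [Set.uIcc_of_le (by linarith)]
    have hmono := intervalIntegral.integral_mono_on (by linarith : -ell1 D ≤ ell1 D) hintS hint2 hpt
    refine hmono.trans ?_
    rw [intervalIntegral.integral_const_mul]
    have hω74 : ∫ v in (-ell1 D)..ell1 D, ‖omegaW D ((z : ℂ) + s0 D + v * I)‖ ≤
        2 * π * Real.exp (1 / 4) := by
      have h := SmoothWeight.integral_norm_omega_segment_le_of_abs_le hℓ2pos (t0 D) hzabs hℓ1pos.le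
      simpa only [omegaW, s0] using h
    exact mul_le_mul_of_nonneg_left hω74 hMV
  -- assemble
  have hcard : (T.card : ℝ) ≤ frakP D := cardPsiOneLe_holds D χ
  calc (∑ x ∈ T, ‖∑ ρ ∈ finsetOf (zeroSet D x),
          ((‖x.ψ.LFunction (ρ + beta1 c' D) / deriv x.ψ.LFunction ρ‖ : ℝ) : ℂ) * H x ρ * omegaW D ρ‖)
      ≤ ∑ x ∈ T, (C₇ * ell D ^ 9 *
            ((∫ v in (-ell1 D)..ell1 D,
                ‖H x ((alpha D : ℂ) + s0 D + v * I)‖ * ‖omegaW D ((alpha D : ℂ) + s0 D + v * I)‖) +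
              (∫ v in (-ell1 D)..ell1 D,
                ‖H x (((-alpha D : ℝ) : ℂ) + s0 D + v * I)‖ *
                  ‖omegaW D (((-alpha D : ℝ) : ℂ) + s0 D + v * I)‖)) +
          K * Hmax * Real.exp (-(ell D ^ 10 / 8))) := Finset.sum_le_sum hx
    _ = C₇ * ell D ^ 9 *
          ((∑ x ∈ T, ∫ v in (-ell1 D)..ell1 D,
              ‖H x ((alpha D : ℂ) + s0 D + v * I)‖ * ‖omegaW D ((alpha D : ℂ) + s0 D + v * I)‖) +
            (∑ x ∈ T, ∫ v in (-ell1 D)..ell1 D,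
              ‖H x (((-alpha D : ℝ) : ℂ) + s0 D + v * I)‖ *
                ‖omegaW D (((-alpha D : ℝ) : ℂ) + s0 D + v * I)‖)) +
          T.card * (K * Hmax * Real.exp (-(ell D ^ 10 / 8))) := by
        rw [Finset.sum_add_distrib, Finset.sum_const, nsmul_eq_mul, ← Finset.mul_sum,
          Finset.sum_add_distrib]
    _ ≤ C₇ * ell D ^ 9 * (MV * (2 * π * Real.exp (1 / 4)) + MV * (2 * π * Real.exp (1 / 4))) +
          frakP D * (K * Hmax * Real.exp (-(ell D ^ 10 / 8))) := by
        gcongr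
        · exact hlineInt (alpha D) (Or.inl rfl)
        · exact hlineInt (-alpha D) (Or.inr rfl)
    _ = 2 * (C₇ * (2 * π * Real.exp (1 / 4))) * ell D ^ 9 * MV +
          K * frakP D * Hmax * Real.exp (-(ell D ^ 10 / 8)) := by ring

/-- **The family zero-sum bound for every sufficiently large `c′`, NO hypothesis** (Prop. 2.2 is a tree
theorem for large `c′`: `Skeleton.prop22_eventually`). [cite: Zhang2022LandauSiegel, §13 p.75] -/
theorem zeroSum_family_le_of_lineBound_eventually : ∃ c₀ : ℝ, 0 ≤ c₀ ∧ ∀ c' : ℝ, c₀ ≤ c' →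
    ∃ K : ℝ, 0 ≤ K ∧ ∃ C : ℝ, 0 ≤ C ∧ ForAllLarge fun D _ χ =>
      ∀ (H : Chr D → ℂ → ℂ) (Hmax MV : ℝ), 0 ≤ Hmax → 0 ≤ MV →
      (∀ x : Chr D, ∀ z : ℂ, 0 < z.im → DifferentiableAt ℂ (H x) z) →
      (∀ x : Chr D, ∀ s : ℂ, |s.re - 1 / 2| ≤ alpha D → |s.im - 2 * π * t0 D| ≤ ell1 D + 1 →
        ‖H x s‖ ≤ Hmax) →
      (∀ s : ℂ, |s.re - 1 / 2| = alpha D → |s.im - 2 * π * t0 D| ≤ ell1 D →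
        ∑ x ∈ finsetOf (PsiOne χ), ‖H x s‖ ≤ MV) →
      (∑ x ∈ finsetOf (PsiOne χ), ‖∑ ρ ∈ finsetOf (zeroSet D x),
          ((‖x.ψ.LFunction (ρ + beta1 c' D) / deriv x.ψ.LFunction ρ‖ : ℝ) : ℂ) * H x ρ * omegaW D ρ‖) ≤
        C * ell D ^ 9 * MV + K * frakP D * Hmax * Real.exp (-(ell D ^ 10 / 8)) := by
  obtain ⟨c₀, hc₀, h⟩ := prop22_eventually
  exact ⟨c₀, hc₀, fun c' hc' => zeroSum_family_le_of_lineBound_of_prop22 (hc₀.trans hc') (h c' hc')⟩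

end Literature.NumberTheory.LFunctions.Zhang2022.Typed.Section13

end
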